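import Summits.ABC.IUTFork.Joshi.ATS4GaussianTwistPoints
import Literature.IUT.LogVolume.ArakelovDivisors
import HarnessLib

/-!
# The Gaussian twist points: `ord_v(λ_{a,b}) = 1` at the place `v = (a + bζ₄)` of `ℚ(ζ₄)`

Record file (D-0012) of the abc-iut cell, block E (rung LADDER-ABC:A2.E; seat abc-iut-E-t28, slot T-28 = [J-IV] §5.4–5.7,
authors-first companion chain deciding the literal @[claim] `ATS4.Thm571` of the LANDED row J4:Thm5.7.1). TAKES NO SIDE on
[IUTchIII] Cor. 3.12, on the claims of K. Joshi, or on S. Mochizuki's reports on them; CLASSICAL arithmetic of `ℚ(√−1)`,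
kernel-checked; typed ≠ proved; NO abc claim. No `Cor312*`/`Thm311*` import (E-PLAN R14).

WHAT IS HERE (proof-only). For `p = a² + b²` PRIME and `v = primeV hp = (a + bζ₄)` (`ATS4GaussianTwistPoints`): Bézout in `ℤ`
gives that integers coprime to `p` are not in `v` (`natCast_notMem_primeV`), `ᾱ ∉ v` (`2a = α + ᾱ`, `gcd(2a, p) = 1` for `p`
odd, `0 < a < p`), `ζ₄ ∉ v` (a unit); hence `ord_v(ζ₄) = ord_v(ᾱ) = 0`, `ord_v(α) = 1` (`v ∣ (α)`, `v² ∤ (α)`), `ord_v(p) = 1`,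
and **`ord_lam : ord_v(λ_{a,b}) = 1`** (`λ = ζ₄α²/p`); `|2|_v = 1` (`valuation_two_primeV`), `15 ∉ v` for `p ≠ 3, 5` — the
place-level hypotheses of `not_isGalois_fieldOfModuli_thetaField` (`ATS4LegendreThetaFieldNonGalois`). `ord` is the tree's
`Literature.IUT.LogVolume.ord`. Theorems only. [folklore]
-/

noncomputable section

open scoped Classical

open NumberField IsDedekindDomain IsCyclotomicExtension Polynomial
open Literature.IUT.LogVolume Literature.IUT.LogVolume.Cor22
open Literature.NumberTheory.DiophantineGeometry.GenEll

namespace Summit.ABC.IUTFork.Joshi.ATS4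

/-! ## 3. The prime `v = (a + bζ₄)` of `ℤ[ζ₄]` and `ord_v(λ) = 1` -/

section Prime

variable (a b : ℕ)









variable {a b}




/-- `p ∈ v`. [folklore] -/
theorem natCast_p_mem_primeV (hp : (a ^ 2 + b ^ 2).Prime) : ((a ^ 2 + b ^ 2 : ℕ) : 𝓞 K4) ∈ (primeV hp).asIdeal := by
  show ((a ^ 2 + b ^ 2 : ℕ) : 𝓞 K4) ∈ Ideal.span {alphaInt a b}
  rw [Ideal.mem_span_singleton']
  exact ⟨alphaBarInt a b, by rw [mul_comm, alphaInt_mul_alphaBarInt]⟩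

/-- A natural number coprime to `p` is not in `v` (Bézout). [folklore] -/
theorem natCast_notMem_primeV (hp : (a ^ 2 + b ^ 2).Prime) {n : ℕ} (hn : n.Coprime (a ^ 2 + b ^ 2)) :
    (n : 𝓞 K4) ∉ (primeV hp).asIdeal := by
  intro hmem
  apply (primeV hp).isPrime.ne_top
  rw [Ideal.eq_top_iff_one]
  obtain ⟨u, w, huw⟩ := Nat.isCoprime_iff_coprime.2 hn
  have h1 : (u : 𝓞 K4) * (n : 𝓞 K4) + (w : 𝓞 K4) * ((a ^ 2 + b ^ 2 : ℕ) : 𝓞 K4) = 1 := by exact_mod_cast congrArg (Int.cast : ℤ → 𝓞 K4) huw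
  rw [← h1]
  exact Ideal.add_mem _ (Ideal.mul_mem_left _ _ hmem) (Ideal.mul_mem_left _ _ (natCast_p_mem_primeV hp))


/-- `ᾱ ∉ v`: otherwise `2a = α + ᾱ ∈ v` and `p ∈ v` with `gcd(2a, p) = 1` (`p` odd, `0 < a < p`). [folklore] -/
theorem alphaBarInt_notMem_primeV (hp : (a ^ 2 + b ^ 2).Prime) (hp2 : a ^ 2 + b ^ 2 ≠ 2) :
    alphaBarInt a b ∉ (primeV hp).asIdeal := by
  intro hmem
  obtain ⟨ha, hb⟩ := pos_of_prime hp
  have h2a : ((2 * a : ℕ) : 𝓞 K4) ∈ (primeV hp).asIdeal := by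
    have : ((2 * a : ℕ) : 𝓞 K4) = alphaInt a b + alphaBarInt a b := by
      simp only [alphaInt, alphaBarInt]; push_cast; ring
    rw [this]
    exact Ideal.add_mem _ (Ideal.subset_span rfl) hmem
  refine natCast_notMem_primeV hp ?_ h2a
  refine Nat.Coprime.mul_left ((Nat.coprime_primes Nat.prime_two hp).2 (Ne.symm hp2)) ?_
  refine (Nat.coprime_comm.1 ((Nat.Prime.coprime_iff_not_dvd hp).2 fun hdvd => ?_))
  have hle := Nat.le_of_dvd ha hdvd
  have : a ^ 2 + b ^ 2 ≤ a := hle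
  nlinarith

/-- `ζ₄ ∉ v` (a unit). [folklore] -/
theorem zetaInt_notMem_primeV (hp : (a ^ 2 + b ^ 2).Prime) : zetaInt ∉ (primeV hp).asIdeal := by
  intro hmem
  apply (primeV hp).isPrime.ne_top
  rw [Ideal.eq_top_iff_one]
  have h4 : (zetaInt : 𝓞 K4) ^ 4 = 1 := by
    apply RingOfIntegers.coe_injective
    simp only [map_pow, map_one]
    exact zeta4_isPrimitiveRoot.pow_eq_one
  rw [← h4]
  exact Ideal.pow_mem_of_mem _ hmem 4 (by norm_num)

/-- `ord_v(ζ₄) = 0`. [folklore] -/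
theorem ord_zeta4 (hp : (a ^ 2 + b ^ 2).Prime) : ord K4 (primeV hp) zeta4 = 0 := by
  have h0 := ord_nonneg_of_isIntegral (F := K4) (primeV hp) zetaInt
  have hne : (zetaInt : 𝓞 K4) ≠ 0 := fun h => zeta4_ne_zero (by rw [← coe_zetaInt, h]; rfl)
  have h1 := (ord_pos_iff_mem (F := K4) (primeV hp) zetaInt hne).not.mpr (zetaInt_notMem_primeV hp)
  rw [coe_zetaInt] at h0 h1
  omega

/-- `ord_v(ᾱ) = 0`. [folklore] -/
theorem ord_alphaBar (hp : (a ^ 2 + b ^ 2).Prime) (hp2 : a ^ 2 + b ^ 2 ≠ 2) :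
    ord K4 (primeV hp) (alphaBar a b) = 0 := by
  have h0 := ord_nonneg_of_isIntegral (F := K4) (primeV hp) (alphaBarInt a b)
  have hne : alphaBarInt a b ≠ 0 := fun h => alphaBar_ne_zero hp.ne_zero (by rw [← coe_alphaBarInt, h]; rfl)
  have h1 := (ord_pos_iff_mem (F := K4) (primeV hp) _ hne).not.mpr (alphaBarInt_notMem_primeV hp hp2)
  rw [coe_alphaBarInt] at h0 h1
  omega

/-- `ord_v(α) = 1` (`v = (α)` exactly: `v ∣ (α)` and `v² ∤ (α)`). [folklore] -/
theorem ord_alphaK (hp : (a ^ 2 + b ^ 2).Prime) : ord K4 (primeV hp) (alphaK a b) = 1 := by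
  set v := primeV hp with hv
  have hne : alphaInt a b ≠ 0 := alphaInt_ne_zero hp.ne_zero
  have hval : v.valuation K4 (alphaK a b) = v.intValuation (alphaInt a b) := by
    rw [← coe_alphaInt]; exact v.valuation_of_algebraMap (alphaInt a b)
  have hv0 : v.intValuation (alphaInt a b) ≠ 0 := v.intValuation_ne_zero _ hne
  have h1 : v.intValuation (alphaInt a b) ≤ WithZero.exp (-(1 : ℕ) : ℤ) := by
    rw [v.intValuation_le_pow_iff_dvd]
    exact ⟨1, by rw [pow_one, mul_one]; rfl⟩
  have h2 : ¬ v.intValuation (alphaInt a b) ≤ WithZero.exp (-(2 : ℕ) : ℤ) := by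
    rw [v.intValuation_le_pow_iff_dvd]
    intro hdvd
    have hle : v.asIdeal ≤ v.asIdeal ^ 2 := Ideal.le_of_dvd hdvd
    have hlt : v.asIdeal ^ 2 < v.asIdeal ^ 1 :=
      Ideal.pow_right_strictAnti v.asIdeal v.ne_bot v.isPrime.ne_top (by norm_num : 1 < 2)
    rw [pow_one] at hlt
    exact lt_irrefl _ (lt_of_le_of_lt hle hlt)
  unfold ord
  rw [hval]
  have h1' := (WithZero.log_le_iff_le_exp hv0).2 h1
  have h2' : ¬ WithZero.log (v.intValuation (alphaInt a b)) ≤ (-(2 : ℕ) : ℤ) := fun h =>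
    h2 ((WithZero.log_le_iff_le_exp hv0).1 h)
  push_cast at h1' h2'
  omega

/-- `ord_v(p) = 1` (`p = αᾱ`, `ord_v(ᾱ) = 0`: `p` is unramified and split at `v`). [folklore] -/
theorem ord_natCast_p (hp : (a ^ 2 + b ^ 2).Prime) (hp2 : a ^ 2 + b ^ 2 ≠ 2) :
    ord K4 (primeV hp) ((a ^ 2 + b ^ 2 : ℕ) : K4) = 1 := by
  rw [← alphaK_mul_alphaBar, ord_mul _ _ (alphaK_ne_zero hp.ne_zero) (alphaBar_ne_zero hp.ne_zero),
    ord_alphaK hp, ord_alphaBar hp hp2]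
  norm_num

/-- **`ord_v(λ) = 1`** (`λ = ζα²/p`: `0 + 2·1 − 1`). [folklore] -/
theorem ord_lam (hp : (a ^ 2 + b ^ 2).Prime) (hp2 : a ^ 2 + b ^ 2 ≠ 2) :
    ord K4 (primeV hp) (lam a b) = 1 := by
  have hp0 : ((a ^ 2 + b ^ 2 : ℕ) : K4) ≠ 0 := by exact_mod_cast hp.ne_zero
  have hα := alphaK_ne_zero hp.ne_zero
  rw [lam, div_eq_mul_inv, ord_mul _ _ (mul_ne_zero zeta4_ne_zero (pow_ne_zero 2 hα)) (inv_ne_zero hp0),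
    ord_mul _ _ zeta4_ne_zero (pow_ne_zero 2 hα), ord_inv, ord_pow, ord_zeta4 hp, ord_alphaK hp,
    ord_natCast_p hp hp2]
  norm_num

/-- `|2|_v = 1` for `p` odd. [folklore] -/
theorem valuation_two_primeV (hp : (a ^ 2 + b ^ 2).Prime) (hp2 : a ^ 2 + b ^ 2 ≠ 2) :
    (primeV hp).valuation K4 (2 : K4) = 1 := by
  have hmem : (2 : 𝓞 K4) ∉ (primeV hp).asIdeal := by
    have h := natCast_notMem_primeV hp ((Nat.coprime_primes Nat.prime_two hp).2 (Ne.symm hp2))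
    simpa using h
  have h := ((primeV hp).valuation_lt_one_iff_mem (K := K4) (2 : 𝓞 K4)).not.mpr hmem
  have hle := (primeV hp).valuation_le_one (K := K4) (2 : 𝓞 K4)
  simp only [map_ofNat] at h hle
  exact le_antisymm hle (not_lt.mp h)

/-- `15 ∉ v` for `p ∉ {3, 5}`. [folklore] -/
theorem fifteen_notMem_primeV (hp : (a ^ 2 + b ^ 2).Prime) (hp3 : a ^ 2 + b ^ 2 ≠ 3) (hp5 : a ^ 2 + b ^ 2 ≠ 5) :
    ((15 : ℕ) : 𝓞 K4) ∉ (primeV hp).asIdeal := by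
  refine natCast_notMem_primeV hp ?_
  rw [show (15 : ℕ) = 3 * 5 by norm_num]
  exact Nat.Coprime.mul_left ((Nat.coprime_primes Nat.prime_three hp).2 (Ne.symm hp3))
    ((Nat.coprime_primes (by norm_num) hp).2 (Ne.symm hp5))

end Prime

end Summit.ABC.IUTFork.Joshi.ATS4

end
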